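import Summits.KontsevichZagierPeriods.KontsevichZagierPeriods.Theses.AbelContraction
import Summits.KontsevichZagierPeriods.KontsevichZagierPeriods.Theses.HodgeLevel
import Summits.KontsevichZagierPeriods.KontsevichZagierPeriods.Theses.DessinsDimensionOne
import Summits.KontsevichZagierPeriods.KontsevichZagierPeriods.Theses.BianchiHumbert
import Summits.KontsevichZagierPeriods.KontsevichZagierPeriods.Theorems.AbelContractionRealArcKernelStrength
import Summits.KontsevichZagierPeriods.KontsevichZagierPeriods.Theorems.SymplecticScissorsPlanarTransport

/-!
# Line `level_two` — skeleton for the crux `KZDimTwo` (stmt-KontsevichZagierPeriods-4280, shared by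
# AbelContraction / HodgeLevel (`DimTwoRationalStratum`) / DessinsDimensionOne / BianchiHumbert)

`KZDimTwo`: Conjecture 1 on the stratum of KZ-rational representations of dimensions `≤ 2`.

Line: THE LEVEL NORMAL FORM ("dimension two is still about curves, of length ≤ 2"). An alternative
to the registered line `Cruxes/ExcursionBudget/Lines/bounded_solids.lean` (VOLUME normal form: bounded
`ℚ`-semialgebraic solids in `ℝ³`, open stub = Hilbert III for such solids). Here the normal form is
HodgeLevel's LEVEL LEMMA inside the calculus and the open content is cut along the DEPTH filtration:

* `stub_levelNormalForm` — every KZ-rational representation of dimension `2` is congruent modulo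
  `KZ.relations` to a `ℤ`-combination of (a) constants, (b) one-dimensional representations,
  (c) LOG-AREAS `[S ⊆ {y > 0}, h(x)/y]` and (d) ARCTAN-AREAS `[S, h(x)/(1 + y²)]`. VERBATIM the
  statement of the shared item stmt-KontsevichZagierPeriods-4989 `HodgeLevel.DimTwoNormalForm`
  (`stub_levelNormalForm_iff_dimTwoNormalForm : … ↔ … := Iff.rfl`); cylindrical decomposition,
  partial fractions in the fibre variable, Hermite reduction (rule 3 with the RATIONAL part of the
  primitive), shears and fibrewise dilations (rule 2). Open, L.
* `stub_huberWustholzCurvePeriods` — the DEPTH-ONE input, literature debt BY NAME: the tree's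
  cite-only named fact `HuberWustholzCurvePeriods` (Huber–Wüstholz 2022, Thm 13.3 (2)); through the
  LANDED `planarAreas_of_huberWustholzCurvePeriods` (SymplecticScissors), `equivalent_of_value_eq_of_planarAreas`
  (AbelContraction, stmt-0117) and `exists_sub_of_mem_closure_dimLEOne` (RealArcKernelStrength) it
  gives the depth-one kernel: every value-`0` `ℤ`-combination of constants and one-dimensional
  representations lies in `KZ.relations` (`depthOneKernel_of_huberWustholz`, sorry-free below).
* `stub_depthTwoLayer` — THE OPEN CONTENT, the depth-two layer RELATIVE to depth one: every subgroup
  `R ≥ KZ.relations` containing the depth-one kernel contains every value-`0` `ℤ`-combination of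
  (a)–(d). Its values are the periods of curve-type motives of length `≤ 2` with a logarithmic
  letter (`∫ h·log g`, `∫ h·arctan g` over algebraic arcs: `Li₂`/Clausen/`L(2,χ)`/`π log α`/
  `log α log β` at genus `0`, elliptic dilogarithm-type integrals at genus `≥ 1`); the summit implies
  it (kernel form, monotonicity in `R`); it gives neither the summit nor the crux by itself.
* `kzDimTwo_of_hyps` (sorry-free implication: the three statements ⟹ equivalence on the stratum)
  and `KZDimTwo_of` (the skeleton: stubs BY NAME ⟹ the route decl
  `…Theses.AbelContraction.KZDimTwo` BY NAME; `_of_hodgeLevel`, `_of_dessins`, `_of_bianchiHumbert`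
  the shared copies). Real proof: normal forms of both sides (dimension `< 2`: the generator itself),
  depth-one kernel from Huber–Wüstholz, depth-two layer at `R := KZ.relations`, soundness, reassembly
  in the free abelian group.
* `kzDimTwo_of_items` — the ROUTE-LEVEL glue of the typed decomposition
  `DimTwoNormalForm (4989) → PlanarAreas (4990) → DepthTwoLayer → KZDimTwo`, sorry-free (the item
  `PlanarAreas` in place of the named fact).

Sources: KontsevichZagier2001 §1.2; HuberWustholz2022 Thm 13.3 (2), §§12–13; DeligneHodgeII1971 §3.2
(level of hypersurface complements); Zagier2007 (dilogarithm), Milnor1982 (Clausen values);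
HuberMullerStachPeriods2017 Ch. 12 (naive periods are periods of pairs).
-/

namespace Summit.KontsevichZagierPeriods.KontsevichZagierPeriods.Cruxes.KZDimTwo.LevelTwo

open Literature.NumberTheory.Transcendental
open Summit.KontsevichZagierPeriods.KontsevichZagierPeriods.Theses.AbelContraction (KZDimTwo)

/-! ### The generator classes of the level normal form (notation only; the stubs inline them) -/

/-- (a) constants and (b) one-dimensional representations: the generators of depth `≤ 1`. -/
def gen01 : Set KZ.FormalRep :=
  {c : KZ.FormalRep | ∃ (s : KZ.IntegralRep 0), c = KZ.of s} ∪ {c | ∃ (s : KZ.IntegralRep 1), c = KZ.of s}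

/-- (c) log-areas `[S ⊆ {y > 0}, h(x)/y]`. -/
def logAreas : Set KZ.FormalRep :=
  {c | ∃ (s : KZ.IntegralRep 2) (h : ℝ → ℝ), s.domain ⊆ {p | 0 < p 1} ∧
    Set.EqOn s.integrand (fun p => h (p 0) / p 1) s.domain ∧ c = KZ.of s}

/-- (d) arctan-areas `[S, h(x)/(1 + y²)]`. -/
def arctanAreas : Set KZ.FormalRep :=
  {c | ∃ (s : KZ.IntegralRep 2) (h : ℝ → ℝ),
    Set.EqOn s.integrand (fun p => h (p 0) / (1 + (p 1) ^ 2)) s.domain ∧ c = KZ.of s}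

/-- The level-`≤ 1` generators of depth `≤ 2`: (a) ∪ (b) ∪ (c) ∪ (d). -/
def gen2 : Set KZ.FormalRep := gen01 ∪ logAreas ∪ arctanAreas

/-! ### The stubs -/

/-- STUB 1 (the level normal form = item stmt-KontsevichZagierPeriods-4989 `HodgeLevel.DimTwoNormalForm`
verbatim; open, L): every KZ-rational representation of dimension `2` is congruent modulo
`KZ.relations` to a `ℤ`-combination of constants, one-dimensional representations, log-areas and
arctan-areas. -/
theorem stub_levelNormalForm : ∀ (r : KZ.IntegralRep 2), r.IsRational →
    ∃ x ∈ AddSubgroup.closure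
      ({c : KZ.FormalRep | ∃ (s : KZ.IntegralRep 0), c = KZ.of s} ∪
        {c | ∃ (s : KZ.IntegralRep 1), c = KZ.of s} ∪
        {c | ∃ (s : KZ.IntegralRep 2) (h : ℝ → ℝ), s.domain ⊆ {p | 0 < p 1} ∧
          Set.EqOn s.integrand (fun p => h (p 0) / p 1) s.domain ∧ c = KZ.of s} ∪
        {c | ∃ (s : KZ.IntegralRep 2) (h : ℝ → ℝ),
          Set.EqOn s.integrand (fun p => h (p 0) / (1 + (p 1) ^ 2)) s.domain ∧ c = KZ.of s}),
      KZ.of r - x ∈ KZ.relations := by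
  sorry

/-- STUB 2 (depth-one input, literature debt BY NAME): Huber–Wüstholz 2022, Thm 13.3 (2), the
tree's cite-only named fact. -/
theorem stub_huberWustholzCurvePeriods : HuberWustholzCurvePeriods := by
  sorry

/-- STUB 3 (THE OPEN CONTENT — the depth-two layer relative to depth one): every subgroup
`R ≥ KZ.relations` containing every value-`0` `ℤ`-combination of constants and one-dimensional
representations contains every value-`0` `ℤ`-combination of constants, one-dimensional
representations, log-areas and arctan-areas. -/
theorem stub_depthTwoLayer : ∀ R : AddSubgroup KZ.FormalRep, KZ.relations ≤ R →
    (∀ x ∈ AddSubgroup.closure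
      ({c : KZ.FormalRep | ∃ (s : KZ.IntegralRep 0), c = KZ.of s} ∪
        {c | ∃ (s : KZ.IntegralRep 1), c = KZ.of s}), KZ.eval x = 0 → x ∈ R) →
    ∀ x ∈ AddSubgroup.closure
      ({c : KZ.FormalRep | ∃ (s : KZ.IntegralRep 0), c = KZ.of s} ∪
        {c | ∃ (s : KZ.IntegralRep 1), c = KZ.of s} ∪
        {c | ∃ (s : KZ.IntegralRep 2) (h : ℝ → ℝ), s.domain ⊆ {p | 0 < p 1} ∧
          Set.EqOn s.integrand (fun p => h (p 0) / p 1) s.domain ∧ c = KZ.of s} ∪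
        {c | ∃ (s : KZ.IntegralRep 2) (h : ℝ → ℝ),
          Set.EqOn s.integrand (fun p => h (p 0) / (1 + (p 1) ^ 2)) s.domain ∧ c = KZ.of s}),
      KZ.eval x = 0 → x ∈ R := by
  sorry

/-! ### Book-keeping: the stubs are the named classes; stub 1 IS item 4989 -/

theorem stub_levelNormalForm_iff_dimTwoNormalForm :
    (∀ (r : KZ.IntegralRep 2), r.IsRational → ∃ x ∈ AddSubgroup.closure gen2,
      KZ.of r - x ∈ KZ.relations) ↔
    Summit.KontsevichZagierPeriods.KontsevichZagierPeriods.Theses.HodgeLevel.DimTwoNormalForm :=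
  Iff.rfl

/-- Soundness in value form. -/
theorem eval_eq_zero_of_mem {c : KZ.FormalRep} (hc : c ∈ KZ.relations) : KZ.eval c = 0 :=
  (AddMonoidHom.mem_ker).mp (KZ.relations_le_ker_eval_holds hc)

/-- THE DEPTH-ONE KERNEL from the depth-one input: every value-`0` `ℤ`-combination of constants and
one-dimensional representations is a relation — PlanarAreas from Huber–Wüstholz (landed transfer,
SymplecticScissors), all equal-valued one-dimensional pairs from PlanarAreas (landed, stmt-0117), and
the normal form `x ≡ [r] − [r′]` inside dimension one (landed, RealArcKernelStrength). Sorry-free. -/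
theorem depthOneKernel_of_planarAreas
    (hP : ∀ (s s' : KZ.IntegralRep 2), (∀ p ∈ s.domain, s.integrand p = 1) →
      (∀ p ∈ s'.domain, s'.integrand p = 1) → s.value = s'.value → KZ.Equivalent s s') :
    ∀ x ∈ AddSubgroup.closure gen01, KZ.eval x = 0 → x ∈ KZ.relations := by
  intro x hx hx0
  have hx' : x ∈ AddSubgroup.closure
      ({x : KZ.FormalRep | ∃ r : KZ.IntegralRep 1, x = KZ.of r} ∪
        {x : KZ.FormalRep | ∃ c : KZ.IntegralRep 0, x = KZ.of c}) := by
    have e : gen01 = ({x : KZ.FormalRep | ∃ r : KZ.IntegralRep 1, x = KZ.of r} ∪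
        {x : KZ.FormalRep | ∃ c : KZ.IntegralRep 0, x = KZ.of c}) := Set.union_comm _ _
    rw [← e]; exact hx
  obtain ⟨r, r', h⟩ :=
    Summit.KontsevichZagierPeriods.AbelContraction.RealArcKernelStrength.exists_sub_of_mem_closure_dimLEOne hx'
  have hv : r.value = r'.value := by
    have e1 := eval_eq_zero_of_mem h
    simp only [map_sub, KZ.eval_of, hx0] at e1
    linarith
  have hE : KZ.of r - KZ.of r' ∈ KZ.relations :=
    Summit.KontsevichZagierPeriods.AbelContraction.AreasToArcs.equivalent_of_value_eq_of_planarAreas hP r r' hv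
  have e : x = (x - (KZ.of r - KZ.of r')) + (KZ.of r - KZ.of r') := by abel
  rw [e]
  exact add_mem h hE

theorem depthOneKernel_of_huberWustholz (hHW : HuberWustholzCurvePeriods) :
    ∀ x ∈ AddSubgroup.closure gen01, KZ.eval x = 0 → x ∈ KZ.relations :=
  depthOneKernel_of_planarAreas
    (Summit.KontsevichZagierPeriods.SymplecticScissors.PlanarTransport.planarAreas_of_huberWustholzCurvePeriods hHW)

/-- Normal form for every dimension `≤ 2`: in dimensions `0` and `1` the representation is itself a
generator; in dimension `2` use the level normal form. -/
theorem normalForm_of_le_two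
    (h1 : ∀ (r : KZ.IntegralRep 2), r.IsRational → ∃ x ∈ AddSubgroup.closure gen2,
      KZ.of r - x ∈ KZ.relations)
    {n : ℕ} (hn : n ≤ 2) (r : KZ.IntegralRep n) (hr : r.IsRational) :
    ∃ x ∈ AddSubgroup.closure gen2, KZ.of r - x ∈ KZ.relations := by
  interval_cases n
  · exact ⟨KZ.of r, AddSubgroup.subset_closure (Or.inl (Or.inl (Or.inl ⟨r, rfl⟩))),
      by simp [KZ.relations.zero_mem]⟩
  · exact ⟨KZ.of r, AddSubgroup.subset_closure (Or.inl (Or.inl (Or.inr ⟨r, rfl⟩))),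
      by simp [KZ.relations.zero_mem]⟩
  · exact h1 r hr

/-- THE COMPOSITION AS A SORRY-FREE IMPLICATION: level normal form + Huber–Wüstholz + depth-two layer
⟹ Conjecture 1 on the stratum `≤ 2`. -/
theorem kzDimTwo_of_hyps
    (h1 : ∀ (r : KZ.IntegralRep 2), r.IsRational → ∃ x ∈ AddSubgroup.closure gen2,
      KZ.of r - x ∈ KZ.relations)
    (hK1 : ∀ x ∈ AddSubgroup.closure gen01, KZ.eval x = 0 → x ∈ KZ.relations)
    (h3 : ∀ R : AddSubgroup KZ.FormalRep, KZ.relations ≤ R →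
      (∀ x ∈ AddSubgroup.closure gen01, KZ.eval x = 0 → x ∈ R) →
      ∀ x ∈ AddSubgroup.closure gen2, KZ.eval x = 0 → x ∈ R)
    {n m : ℕ} (hn : n ≤ 2) (hm : m ≤ 2) (r : KZ.IntegralRep n) (r' : KZ.IntegralRep m)
    (hr : r.IsRational) (hr' : r'.IsRational) (hv : r.value = r'.value) : KZ.Equivalent r r' := by
  have hK2 := h3 KZ.relations le_rfl hK1
  obtain ⟨x, hxN, hxr⟩ := normalForm_of_le_two h1 hn r hr
  obtain ⟨x', hxN', hxr'⟩ := normalForm_of_le_two h1 hm r' hr'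
  have e1 := eval_eq_zero_of_mem hxr
  have e2 := eval_eq_zero_of_mem hxr'
  simp only [map_sub, KZ.eval_of] at e1 e2
  have h0 : KZ.eval (x - x') = 0 := by rw [map_sub]; linarith
  have hxx' : x - x' ∈ KZ.relations := hK2 _ (sub_mem hxN hxN') h0
  have e : KZ.of r - KZ.of r' = (KZ.of r - x) - (KZ.of r' - x') + (x - x') := by abel
  show KZ.of r - KZ.of r' ∈ KZ.relations
  rw [e]
  exact add_mem (sub_mem hxr hxr') hxx'

/-- THE SKELETON (concludes the route decl `Theses.AbelContraction.KZDimTwo` BY NAME from the three stubs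
BY NAME). -/
theorem KZDimTwo_of : KZDimTwo :=
  fun _ _ hn hm r r' hr hr' hv =>
    kzDimTwo_of_hyps stub_levelNormalForm (depthOneKernel_of_huberWustholz stub_huberWustholzCurvePeriods)
      stub_depthTwoLayer hn hm r r' hr hr' hv

/-- The same skeleton concluding the HodgeLevel copy (`DimTwoRationalStratum`, crux 2 of HodgeLevel). -/
theorem KZDimTwo_of_hodgeLevel :
    Summit.KontsevichZagierPeriods.KontsevichZagierPeriods.Theses.HodgeLevel.DimTwoRationalStratum :=
  fun _ _ hn hm r r' hr hr' hv =>
    kzDimTwo_of_hyps stub_levelNormalForm (depthOneKernel_of_huberWustholz stub_huberWustholzCurvePeriods)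
      stub_depthTwoLayer hn hm r r' hr hr' hv

/-- … the DessinsDimensionOne copy. -/
theorem KZDimTwo_of_dessins :
    Summit.KontsevichZagierPeriods.KontsevichZagierPeriods.Theses.DessinsDimensionOne.KZDimTwo :=
  fun _ _ hn hm r r' hr hr' hv =>
    kzDimTwo_of_hyps stub_levelNormalForm (depthOneKernel_of_huberWustholz stub_huberWustholzCurvePeriods)
      stub_depthTwoLayer hn hm r r' hr hr' hv

/-- … and the BianchiHumbert copy (the item's primary decl). -/
theorem KZDimTwo_of_bianchiHumbert :
    Summit.KontsevichZagierPeriods.KontsevichZagierPeriods.Theses.BianchiHumbert.KZDimTwo :=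
  fun _ _ hn hm r r' hr hr' hv =>
    kzDimTwo_of_hyps stub_levelNormalForm (depthOneKernel_of_huberWustholz stub_huberWustholzCurvePeriods)
      stub_depthTwoLayer hn hm r r' hr hr' hv

/-- ROUTE-LEVEL GLUE of the typed decomposition (strategist census, `## Decomposition`): the ITEMS
`DimTwoNormalForm` (stmt-4989, HodgeLevel) and `PlanarAreas` (stmt-4990, AbelContraction support) and the
depth-two layer give the crux — sorry-free, no named fact. -/
theorem kzDimTwo_of_items
    (h₁ : Summit.KontsevichZagierPeriods.KontsevichZagierPeriods.Theses.HodgeLevel.DimTwoNormalForm)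
    (h₂ : Summit.KontsevichZagierPeriods.KontsevichZagierPeriods.Theses.AbelContraction.PlanarAreas)
    (h₃ : ∀ R : AddSubgroup KZ.FormalRep, KZ.relations ≤ R →
      (∀ x ∈ AddSubgroup.closure gen01, KZ.eval x = 0 → x ∈ R) →
      ∀ x ∈ AddSubgroup.closure gen2, KZ.eval x = 0 → x ∈ R) : KZDimTwo :=
  fun _ _ hn hm r r' hr hr' hv =>
    kzDimTwo_of_hyps h₁ (depthOneKernel_of_planarAreas h₂) h₃ hn hm r r' hr hr' hv

end Summit.KontsevichZagierPeriods.KontsevichZagierPeriods.Cruxes.KZDimTwo.LevelTwo
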